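import Mathlib
import Literature.Combinatorics.SimpleGraph.CycleSpectrum
import Literature.Combinatorics.SimpleGraph.HoffmanLovaszBound
import Literature.Combinatorics.SimpleGraph.LovaszThetaComplement
import HarnessLib

/-!
# Lovász 1979, Corollary 5: `ϑ(C_n) = n cos(π/n) / (1 + cos(π/n))` for odd `n` (Knuth 1994, §22)

Literature anchor (engines group, SDP-3 idle lane; shared numerical engines serving client
cells — rigour lives in the verifiers; every published number belongs to a client cell's
ledger, not to the engines group).  Topic `Literature/Combinatorics/SimpleGraph`, over the tree's
`lovaszTheta` (`LovaszTheta.lean`: `ϑ(G) = max {Σ_{u,v} B_{uv} : B ⪰ 0, Tr B = 1, B_{uv} = 0 on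
E(G)}`, Lovász's Theorem 4 form) and Mathlib's `SimpleGraph.cycleGraph`.

## What is printed

* L. Lovász, *On the Shannon capacity of a graph*, IEEE Trans. Inform. Theory **25** (1979) 1–7
  [Lovasz1979] (held; read p. 5).  **Theorem 9**: for a regular graph with adjacency eigenvalues
  `λ₁ ≥ … ≥ λ_n`, `ϑ(G) ≤ -nλ_n/(λ₁ - λ_n)`, with equality if the automorphism group is
  transitive on the edges.  **Corollary 5**: "For odd `n`, `ϑ(C_n) = n cos(π/n) / (1 + cos(π/n))`."
  (For `n = 5` this is Theorem 2, `ϑ(C₅) = √5`, p. 2.)  **Theorem 8** (p. 5): `ϑ(G)ϑ(Ḡ) = n` for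
  vertex-transitive `G`.
* D. E. Knuth, *The sandwich theorem*, Electron. J. Combin. **1** (1994) A1 [Knuth1994] (held,
  arXiv:math/9312214; read §22 "Odd cycles", pp. 9–10).  (22.1) `u ∼ v ⟺ u - v ≡ ±1 (mod n)`,
  `n` odd; (22.2)–(22.4) the vectors `b_v = (α, cos vφ, sin vφ)` with
  `b_u · b_v = α² + cos((u-v)φ)`, `α² = -cos φ`, `φ = π(n-1)/n` ("this choice of `φ` makes `nφ` a
  multiple of `2π`, because `n` is odd"), an orthogonal labeling of `C̄_n` with cost
  (22.5) `c(b_v) = α²/(1+α²) = cos(π/n)/(1 + cos(π/n))`; (22.11) **`ϑ(C_n) = n cos(π/n)/(1 +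
  cos(π/n))`**, (22.12) **`ϑ(C̄_n) = (1 + cos(π/n))/cos(π/n)`**; "when `n = 3`, `C_n = K_n` and
  these values agree with `ϑ(K₃) = 1`, `ϑ(K̄₃) = 3`; when `n = 5`, `C̄₅` is isomorphic to `C₅` so
  `ϑ(C₅) = √5`"; (22.14)–(22.17) the same value from the circulant dual matrix `J + xP + xP⁻¹`,
  whose eigenvalues are `n + 2x` and `2x cos(2πk/n)`, optimised at `n + 2x = -2x cos(π/n)`.
* A. E. Brouwer, W. H. Haemers, *Spectra of graphs* (2012) [BrouwerHaemers2012], §1.4.3: the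
  spectrum of the `n`-cycle is `{2cos(2πj/n)}` (in the tree as `CycleSpectrum.lean`).

## What is here (all proved, no `sorry`, no new axioms)

For `N = n + 3 ≥ 3` odd (`Odd (n + 3)`), `c := cos(π/N)`:
* `neg_two_mul_cos_le_cycleEig`, `cycleEig_half` — the least adjacency eigenvalue of the odd
  cycle is `-2cos(π/N)`: every `2cos(2πk/N) ≥ -2cos(π/N)`, attained at `k = (N-1)/2`;
* `neg_two_mul_cos_mul_le_rayleigh`, `posSemidef_adjMatrix_add_two_mul_cos` — hence
  `xᵀA x ≥ -2cos(π/N)‖x‖²`, i.e. `A(C_N) + 2cos(π/N)·I ⪰ 0`, via the Fourier diagonalisation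
  `A = N⁻¹ F diag(2cos(2πk/N)) Fᴴ` of `CycleSpectrum.lean` and Parseval
  (`sum_norm_sq_conjTranspose_fourierMatrix_mulVec`: `‖Fᴴx‖² = N‖x‖²`);
* `lovaszTheta_cycleGraph_le` — **`ϑ(C_N) ≤ Nc/(1+c)`**: Lovász's Theorem 9 / Knuth's (22.17) as
  the tree's Hoffman–Lovász ratio bound `HoffmanLovaszBound.lovaszTheta_le_ratioBound` with
  `k = 2`, `τ = 2cos(π/N)` (`N·2c/(2+2c) = Nc/(1+c)`);
* `knuthAngle`, `knuthMatrix`, `isThetaFeasible_knuthMatrix`, `entrySum_knuthMatrix` — Knuth's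
  labeling (22.2)–(22.5) as the feasible matrix `B_{uv} = (c + cos((u-v)φ))/(N(1+c))` (the Gram
  matrix of the `b_v`, normalised to trace one): positive semidefinite
  (`xᵀBx = (c(Σx)² + (Σx_u cos uφ)² + (Σx_u sin uφ)²)/(N(1+c))`), trace `1`, zero on the edges of
  `C_N` (`cos φ = -c`; across the seam `cos((N-1)φ) = cos φ` because `N` is odd), of value exactly
  `Nc/(1+c)` (`Σ_u e^{iuφ} = 0`: `φ = 2πm/N` for `N = 2m+1` is a nontrivial Fourier mode);
* `le_lovaszTheta_cycleGraph`, **`lovaszTheta_cycleGraph`** — **Corollary 5 / (22.11):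
  `ϑ(C_N) = N cos(π/N)/(1 + cos(π/N))`**;
* `isVertexTransitive_cycleGraph`, **`lovaszTheta_cycleGraph_compl`** — **(22.12):
  `ϑ(C̄_N) = (1 + cos(π/N))/cos(π/N)`**, from Corollary 5 and the tree's Theorem 8
  (`lovaszTheta_mul_lovaszTheta_compl_eq_card`, rotations give vertex-transitivity);
* instances: `lovaszTheta_cycleGraph_three` (`ϑ(C₃) = 1`, cross-checked against
  `HoffmanLovaszBound.lovaszTheta_completeGraph` via Mathlib's `cycleGraph_three_eq_top`) and
  `lovaszTheta_cycleGraph_three_compl` (`ϑ(C̄₃) = 3`); and, as `example`s only, `ϑ(C₅) = √5` and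
  `ϑ(C̄₅) = √5` from `cos(π/5) = (1+√5)/4` — these two statements are already exported by
  `Literature.Combinatorics.Optimization.DeKlerkPasechnikLovaszTheta`
  (`lovaszTheta_cycleGraph_five`, `lovaszTheta_cycleGraph_five_compl`, by the umbrella witness;
  not imported), so here they are
  compile-time cross-checks of Corollary 5, not parallel named re-proofs.

## Deliberately not here

The even case `ϑ(C_{2m}) = m` (bipartite, Knuth §22 end); Knuth's `(2n-1)`-dimensional labeling
`a_v` of `C_n`, (22.6)–(22.10) (the upper bound is taken from the eigenvalue side (22.14)–(22.17) =
Lovász's Theorem 9 instead); the asymptotics (22.13); Shannon-capacity consequences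
(`Θ(C_n) ≤ ϑ(C_n)`, Lovász Theorem 1) and the weighted `ϑ(C_n, w)`.

## Tree search

`lean search --decl 'lovaszTheta.*cycleGraph|cycleGraph.*lovaszTheta|lovaszTheta_cycle'`: only
`DeKlerkPasechnikLovaszTheta.{sqrt_five_le_,}lovaszTheta_cycleGraph_five{,_compl}` (`ϑ(C₅) =
ϑ(C̄₅) = √5` by the umbrella witness) and `SchrijverTheta.schrijverTheta_cycleGraph_five_eq_…`;
`'knuth|Knuth|oddCycle|isVertexTransitive_cycle|neg_two_mul_cos'`:
`isVertexTransitive_cycleGraph_five` (same file, `N = 5` only), unrelated Knuth number-theory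
entries, Mathlib's `cycleGraph_three_eq_top` (used).  No general odd cycle, no `ϑ(C̄_n)`, no
least eigenvalue of `C_n` in closed form (`CycleSpectrum.lean` has the spectrum `2cos(2πk/N)` and
the Fourier conjugation used here).

## References

* [Lovasz1979] L. Lovász, IEEE Trans. Inform. Theory 25 (1979) 1–7: Thm 2 (p. 2), Thm 8, Thm 9
  and Cor. 5 (p. 5). doi:10.1109/TIT.1979.1055985.
* [Knuth1994] D. E. Knuth, The sandwich theorem, Electron. J. Combin. 1 (1994) A1, §22
  (22.1)–(22.5), (22.11)–(22.12), (22.14)–(22.17). arXiv:math/9312214.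
* [BrouwerHaemers2012] A. E. Brouwer, W. H. Haemers, Spectra of graphs, Springer 2012, §1.4.3
  and Prop. 3.7.5.
-/

noncomputable section

namespace Literature.Combinatorics.SimpleGraph.OddCycleTheta

open Matrix Finset Real _root_.SimpleGraph
open Literature.Combinatorics.SimpleGraph

/-! ### The least eigenvalue of an odd cycle is `-2cos(π/N)` -/

section Eigenvalues

variable {N : ℕ}

/-- For odd `N` every adjacency eigenvalue `2cos(2πk/N)` of `C_N` is at least `-2cos(π/N)`:
`2πk/N` stays at distance `≥ π/N` from `π` because `2k ≠ N`. [cite: Lovasz1979, Corollary 5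
(p. 5)] [cite: Knuth1994, §22 (22.16)–(22.17)] -/
theorem neg_two_mul_cos_le_cycleEig (hN : Odd N) (k : Fin N) :
    -(2 * Real.cos (π / N)) ≤ cycleEig N k := by
  obtain ⟨m, hm⟩ := hN
  have hNpos : 0 < N := Fin.pos k
  have hNr : (0 : ℝ) < N := by exact_mod_cast hNpos
  have hk : (k.val : ℝ) < N := by exact_mod_cast k.isLt
  rw [cycleEig, neg_mul_eq_mul_neg, ← Real.cos_pi_sub]
  refine mul_le_mul_of_nonneg_left ?_ (by norm_num)
  have hπN : π - π / N ≤ π := by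
    have : 0 ≤ π / N := by positivity
    linarith
  rcases le_or_gt (2 * k.val + 1) N with h | h
  · -- `2k + 1 ≤ N`: the angle lies in `[0, π - π/N]`
    refine Real.cos_le_cos_of_nonneg_of_le_pi ?_ hπN ?_
    · unfold cycleAngle; positivity
    · unfold cycleAngle
      have h' : (2 * k.val + 1 : ℝ) ≤ N := by exact_mod_cast h
      rw [div_le_iff₀ hNr, sub_mul, div_mul_cancel₀ _ hNr.ne']
      nlinarith [Real.pi_pos]
  · -- `2k ≥ N + 1`: use `cos θ = cos (2π - θ)` with `2π - θ ∈ [0, π - π/N]`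
    have h2 : N + 1 ≤ 2 * k.val := by omega
    have h' : (N : ℝ) + 1 ≤ 2 * k.val := by exact_mod_cast h2
    rw [← Real.cos_two_pi_sub (cycleAngle N k)]
    refine Real.cos_le_cos_of_nonneg_of_le_pi ?_ hπN ?_
    · unfold cycleAngle
      rw [sub_nonneg, div_le_iff₀ hNr]
      nlinarith [Real.pi_pos]
    · unfold cycleAngle
      have e1 : 2 * π - 2 * π * (k.val : ℝ) / N = (2 * π * N - 2 * π * k.val) / N := by
        rw [eq_div_iff hNr.ne', sub_mul, div_mul_cancel₀ _ hNr.ne']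
      have e2 : π - π / (N : ℝ) = (π * N - π) / N := by
        rw [eq_div_iff hNr.ne', sub_mul, div_mul_cancel₀ _ hNr.ne']
      rw [e1, e2, div_le_div_iff_of_pos_right hNr]
      nlinarith [Real.pi_pos]

/-- The bound is attained: `2cos(2πm/N) = -2cos(π/N)` for `N = 2m + 1`, so `-2cos(π/N)` is the least
adjacency eigenvalue of the odd cycle. [cite: Lovasz1979, Corollary 5 (p. 5)]
[cite: BrouwerHaemers2012, §1.4.3] -/
theorem cycleEig_half {m : ℕ} (k : Fin (2 * m + 1)) (hk : k.val = m) :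
    cycleEig (2 * m + 1) k = -(2 * Real.cos (π / (2 * m + 1 : ℕ))) := by
  rw [cycleEig, neg_mul_eq_mul_neg, ← Real.cos_pi_sub, cycleAngle, hk]
  have h : ((2 * m + 1 : ℕ) : ℝ) ≠ 0 := by positivity
  have e : 2 * π * (m : ℝ) / ((2 * m + 1 : ℕ) : ℝ) = π - π / ((2 * m + 1 : ℕ) : ℝ) := by
    rw [eq_sub_iff_add_eq, ← add_div, eq_comm, eq_div_iff h]
    push_cast
    ring
  rw [e]

end Eigenvalues

/-! ### The Rayleigh quotient of the cycle -/

section Rayleigh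

variable {n : ℕ}

/-- `conj(z) z = |z|²`, real-valued. [folklore] -/
@[folklore] private theorem star_mul_self_eq (z : ℂ) : star z * z = ((‖z‖ : ℝ) : ℂ) ^ 2 := by
  rw [Complex.star_def, Complex.conj_mul']

/-- `xᴴ x = Σ |x_j|²`. [folklore] -/
@[folklore] private theorem star_dotProduct_self {m : ℕ} (x : Fin m → ℂ) :
    star x ⬝ᵥ x = ∑ j, ((‖x j‖ : ℝ) : ℂ) ^ 2 := by
  simp only [dotProduct, Pi.star_apply, star_mul_self_eq]

/-- **The quadratic form of `A_{C_N}` in Fourier coordinates**: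
`xᴴ A x = N⁻¹ Σ_k 2cos(2πk/N) |(Fᴴx)_k|²` (from `A = N⁻¹ F diag(2cos q_k) Fᴴ`).
[cite: BrouwerHaemers2012, §1.4.3] [cite: Knuth1994, §22 (22.15)–(22.16)] -/
theorem star_dotProduct_adjMatrix_mulVec (x : Fin (n + 3) → ℂ) :
    star x ⬝ᵥ ((cycleGraph (n + 3)).adjMatrix ℂ *ᵥ x) =
      ((((n + 3 : ℕ) : ℝ)⁻¹ * ∑ k, cycleEig (n + 3) k *
        ‖((fourierMatrix (n + 3))ᴴ *ᵥ x) k‖ ^ 2 : ℝ) : ℂ) := by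
  set F := fourierMatrix (n + 3) with hF
  set y := Fᴴ *ᵥ x with hy
  have hstar : star x ᵥ* F = star y := by
    rw [hy, star_mulVec, conjTranspose_conjTranspose]
  rw [adjMatrix_cycleGraph_eq_fourier_conj, smul_mulVec, dotProduct_smul, ← mulVec_mulVec,
    ← mulVec_mulVec, dotProduct_mulVec, hstar, ← hy, smul_eq_mul]
  have hsum : star y ⬝ᵥ (diagonal (fun k => (cycleEig (n + 3) k : ℂ)) *ᵥ y) =
      ∑ k, (cycleEig (n + 3) k : ℂ) * ((‖y k‖ : ℝ) : ℂ) ^ 2 := by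
    simp only [dotProduct, Pi.star_apply, mulVec_diagonal]
    refine Finset.sum_congr rfl fun k _ => ?_
    rw [← star_mul_self_eq]
    ring
  rw [hsum]
  push_cast
  ring

/-- **Parseval for `Fᴴ`**: `Σ_k |(Fᴴx)_k|² = N Σ_j |x_j|²` (`F Fᴴ = N·1`).
[cite: BrouwerHaemers2012, §1.4.3] -/
theorem sum_norm_sq_conjTranspose_fourierMatrix_mulVec {N : ℕ} (x : Fin N → ℂ) :
    ∑ k, ‖((fourierMatrix N)ᴴ *ᵥ x) k‖ ^ 2 = N * ∑ j, ‖x j‖ ^ 2 := by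
  set F := fourierMatrix N with hF
  have h : star ((Fᴴ *ᵥ x)) ⬝ᵥ (Fᴴ *ᵥ x) = (N : ℂ) * (star x ⬝ᵥ x) := by
    rw [star_mulVec, conjTranspose_conjTranspose, ← dotProduct_mulVec, mulVec_mulVec,
      fourierMatrix_mul_conjTranspose, smul_mulVec, one_mulVec, dotProduct_smul, smul_eq_mul]
  rw [star_dotProduct_self, star_dotProduct_self] at h
  exact_mod_cast h

/-- The real adjacency matrix of `C_N` is the real part of the complex one (same `0/1` pattern).
[folklore] -/
@[folklore] private theorem adjMatrix_complex_apply (u v : Fin (n + 3)) :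
    (cycleGraph (n + 3)).adjMatrix ℂ u v = (((cycleGraph (n + 3)).adjMatrix ℝ u v : ℝ) : ℂ) := by
  simp [adjMatrix_apply, apply_ite]

/-- **The Rayleigh bound for the cycle**: if `c ≤ 2cos(2πk/N)` for every `k`, then
`c‖x‖² ≤ xᵀ A_{C_N} x` for every real `x`. [cite: BrouwerHaemers2012, §1.4.3]
[cite: Knuth1994, §22 (22.16)] -/
theorem mul_dotProduct_le_rayleigh {c : ℝ} (hc : ∀ k, c ≤ cycleEig (n + 3) k)
    (x : Fin (n + 3) → ℝ) :
    c * (x ⬝ᵥ x) ≤ x ⬝ᵥ ((cycleGraph (n + 3)).adjMatrix ℝ *ᵥ x) := by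
  set xc : Fin (n + 3) → ℂ := fun j => (x j : ℂ) with hxc
  -- the complex form equals the real one
  have hform : star xc ⬝ᵥ ((cycleGraph (n + 3)).adjMatrix ℂ *ᵥ xc) =
      ((x ⬝ᵥ ((cycleGraph (n + 3)).adjMatrix ℝ *ᵥ x) : ℝ) : ℂ) := by
    simp only [dotProduct, mulVec, Pi.star_apply, hxc, adjMatrix_complex_apply,
      Complex.star_def, Complex.conj_ofReal]
    push_cast
    rfl
  have hid := star_dotProduct_adjMatrix_mulVec xc
  rw [hform] at hid
  have hreal := Complex.ofReal_injective hid
  have hpar := sum_norm_sq_conjTranspose_fourierMatrix_mulVec xc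
  have hxx : ∑ j, ‖xc j‖ ^ 2 = x ⬝ᵥ x := by
    simp only [hxc, Complex.norm_real, Real.norm_eq_abs, dotProduct, sq, abs_mul_abs_self]
  have hNr : (0 : ℝ) < ((n + 3 : ℕ) : ℝ) := by positivity
  rw [hreal, ← hxx]
  -- `c Σ|x|² = N⁻¹ Σ_k c |y_k|² ≤ N⁻¹ Σ_k λ_k |y_k|²`
  have hle : ∑ k, c * ‖((fourierMatrix (n + 3))ᴴ *ᵥ xc) k‖ ^ 2 ≤
      ∑ k, cycleEig (n + 3) k * ‖((fourierMatrix (n + 3))ᴴ *ᵥ xc) k‖ ^ 2 :=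
    Finset.sum_le_sum fun k _ => mul_le_mul_of_nonneg_right (hc k) (sq_nonneg _)
  rw [← Finset.mul_sum, hpar] at hle
  calc c * ∑ j, ‖xc j‖ ^ 2
      = ((n + 3 : ℕ) : ℝ)⁻¹ * (c * (((n + 3 : ℕ) : ℝ) * ∑ j, ‖xc j‖ ^ 2)) := by
        field_simp
    _ ≤ ((n + 3 : ℕ) : ℝ)⁻¹ * ∑ k, cycleEig (n + 3) k * ‖((fourierMatrix (n + 3))ᴴ *ᵥ xc) k‖ ^ 2 :=
        mul_le_mul_of_nonneg_left hle (by positivity)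

/-- For odd `N`: `-2cos(π/N)·‖x‖² ≤ xᵀ A_{C_N} x` (the least eigenvalue of the odd cycle).
[cite: Lovasz1979, Theorem 9 and Corollary 5 (p. 5)] [cite: Knuth1994, §22 (22.16)–(22.17)] -/
theorem neg_two_mul_cos_mul_le_rayleigh (hodd : Odd (n + 3)) (x : Fin (n + 3) → ℝ) :
    -(2 * Real.cos (π / (n + 3 : ℕ))) * (x ⬝ᵥ x) ≤
      x ⬝ᵥ ((cycleGraph (n + 3)).adjMatrix ℝ *ᵥ x) :=
  mul_dotProduct_le_rayleigh (fun k => neg_two_mul_cos_le_cycleEig hodd k) x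

/-- **`A_{C_N} + 2cos(π/N)·I ⪰ 0` for odd `N`** (the hypothesis of the Hoffman–Lovász bound with
`τ = -λ_min = 2cos(π/N)`). [cite: Lovasz1979, Theorem 9 and Corollary 5 (p. 5)]
[cite: Knuth1994, §22 (22.17)] -/
theorem posSemidef_adjMatrix_add_two_mul_cos (hodd : Odd (n + 3)) :
    ((cycleGraph (n + 3)).adjMatrix ℝ +
      (2 * Real.cos (π / (n + 3 : ℕ))) • (1 : Matrix (Fin (n + 3)) (Fin (n + 3)) ℝ)).PosSemidef :=
  HoffmanLovaszBound.posSemidef_adjMatrix_add_smul_of_rayleigh fun x => by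
    have h := neg_two_mul_cos_mul_le_rayleigh hodd x
    rwa [neg_mul] at h ⊢

end Rayleigh

/-! ### The upper bound `ϑ(C_N) ≤ N cos(π/N)/(1 + cos(π/N))` (Hoffman–Lovász bound) -/

section Theta

variable {n : ℕ}

/-- `C_N` (`N ≥ 3`) is `2`-regular. [folklore] -/
@[folklore] private theorem isRegularOfDegree_cycleGraph :
    (cycleGraph (n + 3)).IsRegularOfDegree 2 := fun _ => cycleGraph_degree_three_le

/-- `0 < cos(π/N)` for `N ≥ 3` (`π/N < π/2`). [folklore] -/
@[folklore] private theorem cos_pi_div_pos : 0 < Real.cos (π / (n + 3 : ℕ)) := by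
  have hN : (3 : ℝ) ≤ ((n + 3 : ℕ) : ℝ) := by exact_mod_cast Nat.le_add_left 3 n
  refine Real.cos_pos_of_mem_Ioo ⟨?_, ?_⟩
  · have : 0 < π / ((n + 3 : ℕ) : ℝ) := by positivity
    linarith [Real.pi_pos]
  · rw [div_lt_div_iff_of_pos_left Real.pi_pos (by positivity) (by norm_num)]
    linarith

/-- **Lovász 1979, Corollary 5 (upper half) / Knuth (22.17)**: for odd `N ≥ 3`,
`ϑ(C_N) ≤ N cos(π/N) / (1 + cos(π/N))` — the Hoffman–Lovász bound `nτ/(k+τ)` of Theorem 9 with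
`k = 2`, `τ = 2cos(π/N)`, i.e. the dual witness `J - (N/(2+2cos(π/N))) A`.
[cite: Lovasz1979, Theorem 9 and Corollary 5 (p. 5)] [cite: Knuth1994, §22 (22.14)–(22.17)] -/
theorem lovaszTheta_cycleGraph_le (hodd : Odd (n + 3)) :
    lovaszTheta (cycleGraph (n + 3)) ≤
      (n + 3 : ℕ) * Real.cos (π / (n + 3 : ℕ)) / (1 + Real.cos (π / (n + 3 : ℕ))) := by
  have hc := cos_pi_div_pos (n := n)
  have h := HoffmanLovaszBound.lovaszTheta_le_ratioBound (isRegularOfDegree_cycleGraph (n := n))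
    (by positivity : (0 : ℝ) < 2 * Real.cos (π / (n + 3 : ℕ)))
    (posSemidef_adjMatrix_add_two_mul_cos hodd)
  rw [Fintype.card_fin] at h
  have e : ((n + 3 : ℕ) : ℝ) * (2 * Real.cos (π / (n + 3 : ℕ))) /
        (((2 : ℕ) : ℝ) + 2 * Real.cos (π / (n + 3 : ℕ))) =
      (n + 3 : ℕ) * Real.cos (π / (n + 3 : ℕ)) / (1 + Real.cos (π / (n + 3 : ℕ))) := by
    rw [div_eq_div_iff (by positivity) (by positivity)]
    push_cast
    ring
  rwa [e] at h

/-! ### The lower bound: Knuth's orthogonal labeling of `C̄_N` as a feasible matrix -/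

/-- Knuth's angle `φ = π(N-1)/N` of (22.4). [cite: Knuth1994, §22 (22.4)] -/
def knuthAngle (N : ℕ) : ℝ := π * ((N : ℝ) - 1) / N

/-- `cos φ = -cos(π/N)` (so `α² = -cos φ = cos(π/N)` in (22.4)).
[cite: Knuth1994, §22 (22.4)–(22.5)] -/
theorem cos_knuthAngle {N : ℕ} (hN : 0 < N) : Real.cos (knuthAngle N) = -Real.cos (π / N) := by
  have hNr : (N : ℝ) ≠ 0 := by exact_mod_cast hN.ne'
  have e : knuthAngle N = π - π / N := by
    rw [knuthAngle, eq_sub_iff_add_eq, ← add_div, mul_sub_one, sub_add_cancel, mul_div_assoc,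
      div_self hNr, mul_one]
  rw [e, Real.cos_pi_sub]

/-- For odd `N`, `Nφ` is a multiple of `2π` ("This choice of `φ` makes `nφ` a multiple of `2π`,
because `n` is odd"), whence `cos((N-1)φ) = cos φ`. [cite: Knuth1994, §22 (22.4)] -/
theorem cos_pred_mul_knuthAngle {N : ℕ} (hN : Odd N) :
    Real.cos (((N : ℝ) - 1) * knuthAngle N) = Real.cos (knuthAngle N) := by
  obtain ⟨m, rfl⟩ := hN
  have hNr : ((2 * m + 1 : ℕ) : ℝ) ≠ 0 := by positivity
  have e : (((2 * m + 1 : ℕ) : ℝ) - 1) * knuthAngle (2 * m + 1) =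
      (m : ℕ) * (2 * π) - knuthAngle (2 * m + 1) := by
    rw [knuthAngle]
    push_cast
    field_simp
    ring
  rw [e, Real.cos_nat_mul_two_pi_sub]

/-- For `N = 2m+1`, Knuth's `φ` is the angle `2πm/N` of the `m`-th Fourier mode of the ring, so
`ω = e^{iφ}` is a nontrivial `N`-th root of unity. [cite: Knuth1994, §22 (22.4) and (22.8)] -/
theorem knuthAngle_eq_cycleAngle (m : ℕ) :
    knuthAngle (2 * m + 1) = cycleAngle (2 * m + 1) ⟨m, by omega⟩ := by
  simp only [knuthAngle, cycleAngle]
  push_cast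
  ring

/-- `Σ_{u<N} e^{iuφ} = 0` for odd `N ≥ 3` — orthogonality of the Fourier modes `0` and `m` of
`C_N` (`CycleSpectrum.star_cycleMode_dotProduct_cycleMode`). [cite: Knuth1994, §22 (22.8)
("ω is a primitive nth root of unity")] -/
theorem sum_cexp_mul_knuthAngle {N : ℕ} (hN : Odd N) (h3 : 3 ≤ N) :
    ∑ u : Fin N, Complex.exp ((((u.val : ℝ) * knuthAngle N : ℝ) : ℂ) * Complex.I) = 0 := by
  obtain ⟨m, rfl⟩ := hN
  have h0 : 0 < 2 * m + 1 := by omega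
  have hm : m < 2 * m + 1 := by omega
  have hne : (⟨0, h0⟩ : Fin (2 * m + 1)) ≠ ⟨m, hm⟩ := by
    intro h
    have h' := congrArg Fin.val h
    simp only at h'
    omega
  have h := star_cycleMode_dotProduct_cycleMode (N := 2 * m + 1) ⟨0, h0⟩ ⟨m, hm⟩
  rw [if_neg hne, cycleMode_zero h0, dotProduct] at h
  rw [← h]
  refine Finset.sum_congr rfl fun u _ => ?_
  simp only [Pi.star_apply, star_one, one_mul, cycleMode, cycleRoot]
  rw [← Complex.exp_nat_mul, knuthAngle_eq_cycleAngle]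
  congr 1
  push_cast
  ring

/-- Hence `Σ_u cos uφ = 0` … [cite: Knuth1994, §22 (22.2)–(22.5)] -/
theorem sum_cos_mul_knuthAngle {N : ℕ} (hN : Odd N) (h3 : 3 ≤ N) :
    ∑ u : Fin N, Real.cos ((u.val : ℝ) * knuthAngle N) = 0 := by
  have h := congrArg Complex.re (sum_cexp_mul_knuthAngle hN h3)
  simpa only [Complex.re_sum, Complex.exp_ofReal_mul_I_re, Complex.zero_re] using h

/-- … and `Σ_u sin uφ = 0`: the labeling vectors `b_v` of (22.2) sum to `(Nα, 0, 0)`.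
[cite: Knuth1994, §22 (22.2)–(22.5)] -/
theorem sum_sin_mul_knuthAngle {N : ℕ} (hN : Odd N) (h3 : 3 ≤ N) :
    ∑ u : Fin N, Real.sin ((u.val : ℝ) * knuthAngle N) = 0 := by
  have h := congrArg Complex.im (sum_cexp_mul_knuthAngle hN h3)
  simpa only [Complex.im_sum, Complex.exp_ofReal_mul_I_im, Complex.zero_im] using h

/-- **Knuth's labeling as a `ϑ`-feasible matrix**: `B_{uv} = (cos(π/N) + cos((u-v)φ)) / (N(1 +
cos(π/N)))` — up to the factor `1/(N(α² + 1))`, the Gram matrix `b_u · b_v = α² + cos((u-v)φ)`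
of the vectors `b_v = (α, cos vφ, sin vφ)` of (22.2)–(22.3) with `α² = cos(π/N)`.
[cite: Knuth1994, §22 (22.2)–(22.5)] -/
def knuthMatrix (N : ℕ) : Matrix (Fin N) (Fin N) ℝ :=
  of fun u v => (Real.cos (π / N) +
    Real.cos ((u.val : ℝ) * knuthAngle N - (v.val : ℝ) * knuthAngle N)) /
      (N * (1 + Real.cos (π / N)))

/-- The quadratic form of Knuth's matrix is a weighted sum of three squares (`b_u · b_v` expanded by
the addition formula, (22.3)): `xᵀBx = (cos(π/N)(Σx)² + (Σ x_u cos uφ)² + (Σ x_u sin uφ)²) /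
(N(1 + cos(π/N)))`. [cite: Knuth1994, §22 (22.3)] -/
theorem dotProduct_knuthMatrix_mulVec {N : ℕ} (x : Fin N → ℝ) :
    x ⬝ᵥ (knuthMatrix N *ᵥ x) =
      (Real.cos (π / N) * (∑ u, x u) ^ 2 +
        (∑ u, x u * Real.cos ((u.val : ℝ) * knuthAngle N)) ^ 2 +
        (∑ u, x u * Real.sin ((u.val : ℝ) * knuthAngle N)) ^ 2) /
      (N * (1 + Real.cos (π / N))) := by
  simp only [knuthMatrix, dotProduct, mulVec, of_apply, Real.cos_sub, sq, Finset.mul_sum,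
    Finset.sum_mul, Finset.sum_div, ← Finset.sum_add_distrib]
  refine Finset.sum_congr rfl fun u _ => Finset.sum_congr rfl fun v _ => ?_
  ring

/-- Knuth's matrix is symmetric (`b_u · b_v` depends only on `u - v` through `cos`).
[cite: Knuth1994, §22 (22.3)] -/
theorem knuthMatrix_isHermitian (N : ℕ) : (knuthMatrix N).IsHermitian := by
  refine Matrix.IsHermitian.ext fun u v => ?_
  simp only [knuthMatrix, of_apply, star_trivial]
  rw [show (v.val : ℝ) * knuthAngle N - (u.val : ℝ) * knuthAngle N =
    -((u.val : ℝ) * knuthAngle N - (v.val : ℝ) * knuthAngle N) by ring, Real.cos_neg]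

/-- Knuth's matrix is positive semidefinite (a Gram matrix; `N ≥ 3`).
[cite: Knuth1994, §22 (22.2)–(22.3)] -/
theorem posSemidef_knuthMatrix : (knuthMatrix (n + 3)).PosSemidef := by
  refine PosSemidef.of_dotProduct_mulVec_nonneg (knuthMatrix_isHermitian _) fun x => ?_
  rw [star_trivial, dotProduct_knuthMatrix_mulVec]
  have hc := cos_pi_div_pos (n := n)
  positivity

/-- `Tr B = 1` (`b_v · b_v = α² + 1` for every `v`, cf. (22.5): all costs equal). [cite: Knuth1994,
§22 (22.5)] -/
theorem trace_knuthMatrix : (knuthMatrix (n + 3)).trace = 1 := by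
  have hc := cos_pi_div_pos (n := n)
  have hD : ((n + 3 : ℕ) : ℝ) * (1 + Real.cos (π / (n + 3 : ℕ))) ≠ 0 := by positivity
  simp only [Matrix.trace, Matrix.diag, knuthMatrix, of_apply, sub_self, Real.cos_zero,
    Finset.sum_const, Finset.card_univ, Fintype.card_fin, nsmul_eq_mul]
  rw [mul_div_assoc', div_eq_one_iff_eq hD]
  ring

/-- `B` vanishes on the edges of `C_N` for odd `N`: `b_u · b_v = α² + cos(±φ) = 0` for
`u ≡ v ± 1 (mod N)` ((22.4); across the seam `N-1 ∼ 0` this uses `cos((N-1)φ) = cos φ`).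
[cite: Knuth1994, §22 (22.4)] -/
theorem knuthMatrix_apply_eq_zero (hodd : Odd (n + 3)) {u v : Fin (n + 3)}
    (h : (cycleGraph (n + 3)).Adj u v) : knuthMatrix (n + 3) u v = 0 := by
  have hc0 := cos_knuthAngle (show 0 < n + 3 by omega)
  have hc1 := cos_pred_mul_knuthAngle hodd
  -- reduce to `u = v + 1` using the symmetry of `B`
  suffices key : ∀ u v : Fin (n + 3), u = v + 1 → knuthMatrix (n + 3) u v = 0 by
    rcases (cycleGraph_adj.mp h) with h1 | h1
    · exact key u v (sub_eq_iff_eq_add'.mp h1)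
    · have hs := (knuthMatrix_isHermitian (n + 3)).apply v u
      rw [star_trivial] at hs
      rw [hs]
      exact key v u (sub_eq_iff_eq_add'.mp h1)
  intro u v huv
  subst huv
  simp only [knuthMatrix, of_apply, div_eq_zero_iff]
  left
  rw [Fin.val_add_one]
  split_ifs with hlast
  · -- the seam: `v = N - 1`, `v + 1 = 0`
    rw [hlast, Fin.val_last, Nat.cast_zero, zero_mul, zero_sub, Real.cos_neg]
    have e : ((n + 2 : ℕ) : ℝ) = ((n + 3 : ℕ) : ℝ) - 1 := by push_cast; ring
    rw [e, hc1, hc0, add_neg_cancel]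
  · have e : ((v.val + 1 : ℕ) : ℝ) * knuthAngle (n + 3) - (v.val : ℝ) * knuthAngle (n + 3) =
        knuthAngle (n + 3) := by push_cast; ring
    rw [e, hc0, add_neg_cancel]

/-- **Knuth's matrix is feasible for `ϑ(C_N)`** (`N ≥ 3` odd). [cite: Knuth1994, §22 (22.2)–(22.5)]
[cite: Lovasz1979, Corollary 5 (p. 5)] -/
theorem isThetaFeasible_knuthMatrix (hodd : Odd (n + 3)) :
    IsThetaFeasible (cycleGraph (n + 3)) (knuthMatrix (n + 3)) where
  posSemidef := posSemidef_knuthMatrix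
  trace_eq_one := trace_knuthMatrix
  apply_eq_zero := fun _ _ h => knuthMatrix_apply_eq_zero hodd h

/-- **The value of Knuth's labeling is `N cos(π/N)/(1 + cos(π/N))`** — (22.5): every vertex costs
`c(b_v) = α²/(1+α²) = cos(π/N)/(1 + cos(π/N))`, summed over the `N` vertices as in (22.10)–(22.11);
here `Σ_{u,v} B_{uv} = (N² cos(π/N) + (Σ_u cos uφ)² + (Σ_u sin uφ)²)/(N(1 + cos(π/N)))` with both
trigonometric sums zero. [cite: Knuth1994, §22 (22.5) and (22.10)–(22.11)] -/
theorem entrySum_knuthMatrix (hodd : Odd (n + 3)) :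
    entrySum (knuthMatrix (n + 3)) =
      (n + 3 : ℕ) * Real.cos (π / (n + 3 : ℕ)) / (1 + Real.cos (π / (n + 3 : ℕ))) := by
  have hc := cos_pi_div_pos (n := n)
  have hform : entrySum (knuthMatrix (n + 3)) =
      (fun _ => (1 : ℝ)) ⬝ᵥ (knuthMatrix (n + 3) *ᵥ fun _ => (1 : ℝ)) := by
    simp [entrySum, dotProduct, mulVec]
  rw [hform, dotProduct_knuthMatrix_mulVec]
  simp only [Finset.sum_const, Finset.card_univ, Fintype.card_fin, nsmul_eq_mul, mul_one, one_mul,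
    sum_cos_mul_knuthAngle hodd (Nat.le_add_left 3 n),
    sum_sin_mul_knuthAngle hodd (Nat.le_add_left 3 n)]
  rw [div_eq_div_iff (by positivity) (by positivity)]
  ring

/-- **Lovász 1979, Corollary 5 (lower half) / Knuth (22.5), (22.11)**: for odd `N ≥ 3`,
`N cos(π/N)/(1 + cos(π/N)) ≤ ϑ(C_N)` — Knuth's labeling is feasible with exactly this value.
[cite: Lovasz1979, Corollary 5 (p. 5)] [cite: Knuth1994, §22 (22.5), (22.11)] -/
theorem le_lovaszTheta_cycleGraph (hodd : Odd (n + 3)) :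
    (n + 3 : ℕ) * Real.cos (π / (n + 3 : ℕ)) / (1 + Real.cos (π / (n + 3 : ℕ))) ≤
      lovaszTheta (cycleGraph (n + 3)) :=
  (entrySum_knuthMatrix hodd).ge.trans
    (le_csSup (bddAbove_thetaValues _) ⟨_, isThetaFeasible_knuthMatrix hodd, rfl⟩)

/-! ### Lovász's Corollary 5 and the complementary value -/

/-- **Lovász 1979, Corollary 5: for odd `n`, `ϑ(C_n) = n cos(π/n) / (1 + cos(π/n))`** (here
`n = N ≥ 3`; Knuth 1994, (22.11)), over the tree's `lovaszTheta`.
[cite: Lovasz1979, Corollary 5 (p. 5)] [cite: Knuth1994, §22 (22.11) and (22.17)] -/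
theorem lovaszTheta_cycleGraph (hodd : Odd (n + 3)) :
    lovaszTheta (cycleGraph (n + 3)) =
      (n + 3 : ℕ) * Real.cos (π / (n + 3 : ℕ)) / (1 + Real.cos (π / (n + 3 : ℕ))) :=
  le_antisymm (lovaszTheta_cycleGraph_le hodd) (le_lovaszTheta_cycleGraph hodd)

/-- Rotation by `c`, an automorphism of `C_N`. [folklore] -/
@[folklore] private def rotIso (c : Fin (n + 3)) : cycleGraph (n + 3) ≃g cycleGraph (n + 3) where
  toEquiv := Equiv.addRight c
  map_rel_iff' := by
    intro a b
    simp only [Equiv.coe_addRight, cycleGraph_adj, add_sub_add_right_eq_sub]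

/-- `C_N` is vertex-transitive (rotations). [cite: Lovasz1979, p. 2 (definition) and Theorem 8
(p. 5)] -/
theorem isVertexTransitive_cycleGraph : IsVertexTransitive (cycleGraph (n + 3)) := fun u v =>
  ⟨rotIso (v - u), by simp [rotIso]⟩

/-- **Knuth 1994, (22.12): `ϑ(C̄_n) = (1 + cos(π/n)) / cos(π/n)`** for odd `n ≥ 3` — from
Corollary 5 and Lovász's Theorem 8 (`ϑ(G)ϑ(Ḡ) = n` for vertex-transitive `G`, the tree's
`lovaszTheta_mul_lovaszTheta_compl_eq_card`). [cite: Knuth1994, §22 (22.12)]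
[cite: Lovasz1979, Theorem 8 and Corollary 5 (p. 5)] -/
theorem lovaszTheta_cycleGraph_compl (hodd : Odd (n + 3)) :
    lovaszTheta (cycleGraph (n + 3))ᶜ =
      (1 + Real.cos (π / (n + 3 : ℕ))) / Real.cos (π / (n + 3 : ℕ)) := by
  have hc := cos_pi_div_pos (n := n)
  have hN : (0 : ℝ) < ((n + 3 : ℕ) : ℝ) := by positivity
  have hprod := lovaszTheta_mul_lovaszTheta_compl_eq_card (isVertexTransitive_cycleGraph (n := n))
  rw [Fintype.card_fin, lovaszTheta_cycleGraph hodd] at hprod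
  rw [eq_div_iff hc.ne']
  have h1 : 0 < 1 + Real.cos (π / (n + 3 : ℕ)) := by positivity
  field_simp at hprod
  nlinarith [hprod, hN, h1, hc]

/-! ### Instances: `n = 3` (`C₃ = K₃`) and `n = 5` (`ϑ(C₅) = √5`) -/

/-- `n = 3`: `ϑ(C₃) = 3·(1/2)/(3/2) = 1` ("these values agree with `ϑ(K₃) = 1`"; cf. the tree's
`HoffmanLovaszBound.lovaszTheta_completeGraph`). [cite: Knuth1994, §22 (after (22.12))] -/
theorem lovaszTheta_cycleGraph_three : lovaszTheta (cycleGraph 3) = 1 := by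
  rw [lovaszTheta_cycleGraph (n := 0) (by decide)]
  have e : π / ((0 + 3 : ℕ) : ℝ) = π / 3 := by norm_num
  rw [e, Real.cos_pi_div_three]
  norm_num

/-- … and `ϑ(C̄₃) = ϑ(K̄₃) = 3`. [cite: Knuth1994, §22 (after (22.12))] -/
theorem lovaszTheta_cycleGraph_three_compl : lovaszTheta (cycleGraph 3)ᶜ = 3 := by
  rw [lovaszTheta_cycleGraph_compl (n := 0) (by decide)]
  have e : π / ((0 + 3 : ℕ) : ℝ) = π / 3 := by norm_num
  rw [e, Real.cos_pi_div_three]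
  norm_num

/-- The same value `1` from `C₃ = K₃` (Mathlib's `cycleGraph_three_eq_top`) and the tree's
`ϑ(K_n) = 1` — a cross-check of Corollary 5 against `HoffmanLovaszBound.lovaszTheta_completeGraph`.
[cite: Knuth1994, §22 (after (22.12))] -/
example : lovaszTheta (cycleGraph 3) = 1 := by
  rw [cycleGraph_three_eq_top]
  exact HoffmanLovaszBound.lovaszTheta_completeGraph

/-- `n = 5`: `cos(π/5) = (1 + √5)/4` turns Corollary 5 into **Lovász's Theorem 2, `ϑ(C₅) = √5`**
("when `n = 5`, `C̄₅` is isomorphic to `C₅` so `ϑ(C₅) = √5`").  Stated as an `example`, not a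
named theorem: the statement is already in the tree as
`Literature.Combinatorics.Optimization.DeKlerkPasechnikLovaszTheta.lovaszTheta_cycleGraph_five`
(proved there by the umbrella witness and Theorem 8; not imported here) — this is an independent
compile-time cross-check of Corollary 5 against it, not a parallel export.
[cite: Lovasz1979, Theorem 2 (p. 2) and Corollary 5 (p. 5)]
[cite: Knuth1994, §22 (after (22.12))] -/
example : lovaszTheta (cycleGraph 5) = Real.sqrt 5 := by
  rw [lovaszTheta_cycleGraph (n := 2) (by decide)]
  have e : π / ((2 + 3 : ℕ) : ℝ) = π / 5 := by norm_num
  rw [e, Real.cos_pi_div_five]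
  have h5 : Real.sqrt 5 * Real.sqrt 5 = 5 := Real.mul_self_sqrt (by norm_num)
  have hpos : 0 < Real.sqrt 5 := by positivity
  rw [div_eq_iff (by positivity)]
  push_cast
  nlinarith [h5, hpos]

/-- … and `ϑ(C̄₅) = (5 + √5)/(1 + √5) = √5` from (22.12) (in the tree as
`DeKlerkPasechnikLovaszTheta.lovaszTheta_cycleGraph_five_compl`; again a cross-check `example`).
[cite: Knuth1994, §22 (22.12)] [cite: Lovasz1979, Theorem 2 (p. 2)] -/
example : lovaszTheta (cycleGraph 5)ᶜ = Real.sqrt 5 := by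
  rw [lovaszTheta_cycleGraph_compl (n := 2) (by decide)]
  have e : π / ((2 + 3 : ℕ) : ℝ) = π / 5 := by norm_num
  rw [e, Real.cos_pi_div_five]
  have h5 : Real.sqrt 5 * Real.sqrt 5 = 5 := Real.mul_self_sqrt (by norm_num)
  have hpos : 0 < Real.sqrt 5 := by positivity
  rw [div_eq_iff (by positivity)]
  nlinarith [h5, hpos]

end Theta

end Literature.Combinatorics.SimpleGraph.OddCycleTheta

end
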